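import Mathlib
import Literature.NumberTheory.Transcendental.KZLogCalculusProofs
import Literature.MeasureTheory.Lebesgue.VitaliSet

/-!
# drefute (gen 2) — stub `stub_foldIntegrable` of line `engine-transport`
(crux `UnfoldedLogStokes`, stmt-KontsevichZagierPeriods-2835): the two clauses gen 1 left unmutated

Gen 1 (`Cruxes/UnfoldedLogStokes/DrefuteMutation.lean`) mutated every clause of the registered stub
`stub_foldIntegrable` (skeleton `9328557fb75a`) EXCEPT the semialgebraicity of the two base functions
`h`, `v` ("irrelevant to the line").  This file closes that gap:

* §1 `hv` (`IsSemialgebraicFunOn ℚ σ v`) is LOAD-BEARING — but only through MEASURABILITY: with every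
  other clause kept verbatim, a Vitali slab `S ⊆ ℝ¹` (tree fact
  `Literature.MeasureTheory.Lebesgue.Vitali.exists_innerNull_not_nullMeasurableSet`,
  Wheeden–Zygmund Thm. (3.38)) and `v := 1 + 𝟙_S`, `h := 1`, `g := 1 / max 1 u` give an honest
  instance (the band `ℝ¹ × {1} ∪ S × [1,2]` has finite OUTER measure, so the bounded continuous `g`
  is integrable on it) whose folded integrand `h · log v = log 2 · 𝟙_S` is not even a.e.-measurable:
  `not_foldIntegrableWithoutSAv`.  No semialgebraic (indeed no measurable) `v` can do this, so the
  finding is information for the prover, not a defect of the stub: the stub is a pure measure-theory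
  lemma in which `hσ`, `hh`, `hv` enter only via measurability (cf. the on-file proof
  `Ideator2.defoldIntegrable_holds`, which uses them exactly at `hσm`, `hBm`, `hmeas`).
* §2 `hh` (`IsSemialgebraicFunOn ℚ σ h`) could NOT be broken and is believed REDUNDANT given `hσ`, `hv`:
  integrability of `g` on the band makes `h` a.e.-measurable on `{v > 1} ∩ σ` (Fubini sections
  `u ↦ g(x,u)·u = h x`), and `h · log v = 0` on `{v = 1}`; recorded as a remark only (a positive
  generalisation is not the refuter's to land).
-/

noncomputable section

set_option linter.dupNamespace false

open Set MeasureTheory Metric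
open Literature.NumberTheory.Transcendental
open Literature.ModelTheory.ExponentialFields (IsSemialgebraic isSemialgebraic_univ)

namespace Summit.KontsevichZagierPeriods.KontsevichZagierPeriods.Cruxes.UnfoldedLogStokes.DrefuteG2

/-! ## §0 The registered stub, verbatim (ledger `workitem get stmt-KontsevichZagierPeriods-2835`, skeleton 9328557fb75a) -/

/-- Registered stub `stub_foldIntegrable` (verbatim). -/
def Stub_foldIntegrable : Prop :=
  ∀ (n : ℕ) (σ N : Set (Fin n → ℝ)) (h v : (Fin n → ℝ) → ℝ) (g : (Fin (n + 1) → ℝ) → ℝ), Literature.ModelTheory.ExponentialFields.IsSemialgebraic ℚ σ → Literature.NumberTheory.Transcendental.IsSemialgebraicFunOn ℚ σ h → Literature.NumberTheory.Transcendental.IsSemialgebraicFunOn ℚ σ v → (∀ x ∈ σ, 1 ≤ v x) → MeasureTheory.volume N = 0 → MeasureTheory.IntegrableOn g (Literature.NumberTheory.Transcendental.KZlog.band σ (fun _ => 1) v) → (∀ z ∈ Literature.NumberTheory.Transcendental.KZlog.band σ (fun _ => 1) v, Fin.init z ∉ N → g z = h (Fin.init z) / z (Fin.last n)) → MeasureTheory.IntegrableOn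 (fun x => h x * Real.log (v x)) σ

/-! ## §1 `hv` deleted: FALSE (Vitali slab) -/

/-- `stub_foldIntegrable` with the clause `IsSemialgebraicFunOn ℚ σ v` DELETED (everything else verbatim). -/
def FoldIntegrableWithoutSAv : Prop :=
  ∀ (n : ℕ) (σ N : Set (Fin n → ℝ)) (h v : (Fin n → ℝ) → ℝ) (g : (Fin (n + 1) → ℝ) → ℝ),
    IsSemialgebraic ℚ σ → IsSemialgebraicFunOn ℚ σ h →
    (∀ x ∈ σ, 1 ≤ v x) → volume N = 0 →
    IntegrableOn g (KZlog.band σ (fun _ => 1) v) →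
    (∀ z ∈ KZlog.band σ (fun _ => 1) v, Fin.init z ∉ N → g z = h (Fin.init z) / z (Fin.last n)) →
    IntegrableOn (fun x => h x * Real.log (v x)) σ

/-- A bounded Vitali slab in `ℝ¹`: a set `S ⊆ B(0,1)` which is not null-measurable for Lebesgue
measure (tree fact `Vitali.exists_innerNull_not_nullMeasurableSet`, coordinate functional). -/
theorem exists_bounded_not_nullMeasurableSet_fin_one :
    ∃ S : Set (Fin 1 → ℝ), S ⊆ ball 0 1 ∧ ¬ NullMeasurableSet S volume := by
  obtain ⟨A, -, hS⟩ :=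
    Literature.MeasureTheory.Lebesgue.Vitali.exists_innerNull_not_nullMeasurableSet
      (volume : Measure (Fin 1 → ℝ)) (ContinuousLinearMap.proj (R := ℝ) (φ := fun _ : Fin 1 => ℝ) 0)
      (e := fun _ => 1) (by simp) (fun x => by simpa using norm_le_pi_norm x 0)
      (by simp) 0 zero_lt_one
  exact ⟨A ∩ ball 0 1, inter_subset_right, hS _ Subset.rfl inter_subset_left⟩

theorem sa_one₁ : IsSemialgebraicFunOn ℚ (univ : Set (Fin 1 → ℝ)) (fun _ => (1 : ℝ)) := by
  simpa using isSemialgebraicFunOn_ratCast isSemialgebraic_univ 1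

/-- The hyperplane `{u = 1}` of `ℝ²` is Lebesgue-null. -/
theorem volume_last_eq_one : volume {z : Fin 2 → ℝ | z (Fin.last 1) = 1} = 0 := by
  rw [volume_pi]
  exact Measure.pi_hyperplane (fun _ : Fin 2 => (volume : Measure ℝ)) (Fin.last 1) (1 : ℝ)

/-- FALSE without `hv`: witness `n = 1`, `σ = ℝ¹`, `N = ∅`, `h = 1`, `v = 1 + 𝟙_S` (`S` a bounded
Vitali slab), `g = 1 / max 1 u` (honestly pinned: `= 1/u` on the band).  The band
`ℝ¹ × {1} ∪ S × [1, 2]` has finite outer measure, so `g` IS integrable on it, while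
`h · log v = log 2 · 𝟙_S` is not a.e.-measurable, let alone integrable. -/
theorem not_foldIntegrableWithoutSAv : ¬ FoldIntegrableWithoutSAv := by
  intro H
  obtain ⟨S, hSball, hSnm⟩ := exists_bounded_not_nullMeasurableSet_fin_one
  set v : (Fin 1 → ℝ) → ℝ := fun x => 1 + S.indicator (fun _ => (1 : ℝ)) x with hv_def
  set g : (Fin 2 → ℝ) → ℝ := fun z => 1 / max 1 (z (Fin.last 1)) with hg_def
  have hv1 : ∀ x ∈ (univ : Set (Fin 1 → ℝ)), 1 ≤ v x := fun x _ =>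
    le_add_of_nonneg_right (Set.indicator_nonneg (fun _ _ => zero_le_one) _)
  -- the band is contained in a null hyperplane union a bounded box
  have hband_sub : KZlog.band (univ : Set (Fin 1 → ℝ)) (fun _ => (1 : ℝ)) v ⊆
      {z : Fin 2 → ℝ | z (Fin.last 1) = 1} ∪ Icc (fun _ => (-1 : ℝ)) (fun _ => 2) := by
    intro z hz
    rw [KZlog.mem_band] at hz
    obtain ⟨-, h1, h2⟩ := hz
    by_cases hx : Fin.init z ∈ S
    · right
      have h2' : z (Fin.last 1) ≤ 2 := by
        have : v (Fin.init z) = 2 := by rw [hv_def]; simp only [indicator_of_mem hx]; norm_num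
        rw [this] at h2; exact h2
      have hx0 : |z 0| < 1 := by
        have hb := hSball hx
        rw [mem_ball_zero_iff] at hb
        have := norm_le_pi_norm (Fin.init z) 0
        rw [Real.norm_eq_abs] at this
        have h0 : Fin.init z 0 = z 0 := rfl
        rw [h0] at this
        exact lt_of_le_of_lt this hb
      rw [mem_Icc]
      constructor
      · intro i
        fin_cases i
        · show (-1 : ℝ) ≤ z 0
          exact (abs_lt.1 hx0).1.le
        · show (-1 : ℝ) ≤ z 1
          exact le_trans (by norm_num) (show (1 : ℝ) ≤ z (Fin.last 1) from h1)
      · intro i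
        fin_cases i
        · show z 0 ≤ (2 : ℝ)
          exact le_trans (abs_lt.1 hx0).2.le (by norm_num)
        · show z 1 ≤ (2 : ℝ)
          exact h2'
    · left
      have : v (Fin.init z) = 1 := by rw [hv_def]; simp only [indicator_of_notMem hx, add_zero]
      rw [this] at h2
      exact le_antisymm h2 h1
  have hband_fin : volume (KZlog.band (univ : Set (Fin 1 → ℝ)) (fun _ => (1 : ℝ)) v) < ⊤ := by
    refine lt_of_le_of_lt (measure_mono hband_sub) ?_
    refine lt_of_le_of_lt (measure_union_le _ _) ?_
    rw [volume_last_eq_one, zero_add, Real.volume_Icc_pi]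
    exact ENNReal.prod_lt_top (fun _ _ => ENNReal.ofReal_lt_top)
  -- hence the bounded continuous `g` is integrable on the band
  have hg_cont : Continuous g := by
    refine continuous_const.div (continuous_const.max (continuous_apply _)) fun z => ?_
    exact (lt_of_lt_of_le one_pos (le_max_left _ _)).ne'
  have hg_int : IntegrableOn g (KZlog.band (univ : Set (Fin 1 → ℝ)) (fun _ => (1 : ℝ)) v) := by
    haveI : IsFiniteMeasure
        (volume.restrict (KZlog.band (univ : Set (Fin 1 → ℝ)) (fun _ => (1 : ℝ)) v)) :=
      isFiniteMeasure_restrict.2 hband_fin.ne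
    refine (integrable_const (1 : ℝ)).mono' hg_cont.measurable.aestronglyMeasurable
      (Filter.Eventually.of_forall fun z => ?_)
    have hpos : (0 : ℝ) < max 1 (z (Fin.last 1)) := lt_of_lt_of_le one_pos (le_max_left _ _)
    rw [hg_def, norm_div, norm_one, Real.norm_eq_abs, abs_of_pos hpos]
    exact (div_le_one hpos).2 (le_max_left _ _)
  -- honest pinning
  have hpin : ∀ z ∈ KZlog.band (univ : Set (Fin 1 → ℝ)) (fun _ => (1 : ℝ)) v, Fin.init z ∉ (∅ : Set _) →
      g z = (fun _ => (1 : ℝ)) (Fin.init z) / z (Fin.last 1) := by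
    intro z hz _
    rw [KZlog.mem_band] at hz
    simp only [hg_def, max_eq_right hz.2.1]
  have h := H 1 univ ∅ (fun _ => 1) v g isSemialgebraic_univ sa_one₁ hv1 (by simp) hg_int hpin
  -- the folded integrand is `log 2 · 𝟙_S`, not a.e.-measurable
  have hfun : (fun x => (fun _ => (1 : ℝ)) x * Real.log (v x)) = S.indicator (fun _ => Real.log 2) := by
    ext x
    by_cases hx : x ∈ S
    · simp only [hv_def, indicator_of_mem hx, one_mul]; norm_num
    · simp only [hv_def, indicator_of_notMem hx, add_zero, Real.log_one, mul_zero]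
  rw [hfun, integrableOn_univ] at h
  have hpre : (S.indicator fun _ => Real.log 2) ⁻¹' {Real.log 2} = S := by
    ext x
    by_cases hx : x ∈ S
    · simp [hx]
    · simp only [mem_preimage, indicator_of_notMem hx, mem_singleton_iff, hx, iff_false]
      exact fun h0 => (Real.log_pos one_lt_two).ne' h0.symm
  have hnm : NullMeasurableSet S volume := by
    rw [← hpre]
    exact h.aestronglyMeasurable.aemeasurable.nullMeasurableSet_preimage (measurableSet_singleton _)
  exact hSnm hnm

end Summit.KontsevichZagierPeriods.KontsevichZagierPeriods.Cruxes.UnfoldedLogStokes.DrefuteG2
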